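import Summits.CriticalPhenomena.CardyFormulaZ2.Theorems.CardyComplexConeSLESixFamiliesGiveCardyUpperFencePart1
import Summits.CriticalPhenomena.CardyFormulaZ2.Theorems.CardyComplexConeSLESixFamiliesGiveCardyLowerRunPart1
import Literature.Probability.Percolation.BoxCrossingUpperBound
import Literature.Probability.RandomPlanarGeometry.PlanarDomainsTopology
import Literature.Probability.LatticeModels.MedialPerturbation
import HarnessLib

/-!
# Stub `upperFence` of line `collar-touch-sandwich` — Part 3: the clean cross-cut

Crux `SLESixFamiliesGiveCardy` (stmt-CriticalPhenomena-9654), route `CardyComplexCone`.  Third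
helper file of STUB A `stub_upperFence : UpperFence`.  Geometry of the separating arc of the
fence argument:

* bookkeeping on a Dobrushin domain `D`: `frontier D = arc 0 ∪ arc 1`, the two closed arcs meet
  only at the marks, interior points of the arcs have parameters strictly between the marks;
* `isSimpleArc_connector_meshTrace_connector` — the DIRTY cross-cut: an open crossing `π` of `Ω_δ`
  (a lattice PATH read at mesh `δ`, `meshTrace`) extended at both ends along the first-exit
  connectors `[f_x, δx]`, `[δy, f_y]` of two non-`Ω_δ` lattice edges is a simple arc from `f_x`
  to `f_y` (`isSimpleArc_walkTrace`, `IsSimpleArc.image/union`; a connector meets the trace only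
  at its base point);
* `exists_clean_crosscut` — CLEANING: a simple arc in `closure Ω ⊆ closure D` from a point of
  `D.arc 0` to a point of `D.arc 1` (marks off `closure Ω`) contains a Newman cross-cut `L′` of `D`
  from `D.boundary s` to `D.boundary t` with `mark 0 < s < mark 1 < t < mark 0 + 1`
  (`exists_clean_subarc_subset` of Part 1 + reparametrisation).

Written by the line lead; the dictionary/side lemmas it is combined with are in Parts 1–2.
-/

noncomputable section

open Set Filter Topology Metric
open Literature.Probability Literature.Probability.RandomPlanarGeometry
  Literature.Probability.LatticeModels Literature.Probability.Percolation
open Literature.Topology.PlaneTopology (IsSimpleArc)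

namespace Summit.CriticalPhenomena.CardyFormulaZ2.Cruxes.SLESixFamiliesGiveCardy.CollarTouchSandwich

/-! ### Arcs of a Dobrushin domain -/

/-- On a Dobrushin domain, `nextMark 0 = mark 1`. -/
theorem nextMark_zero_dobrushin (D : DobrushinDomain) : D.nextMark 0 = D.mark 1 :=
  D.nextMark_of_lt 0 (by decide)

/-- On a Dobrushin domain, `nextMark 1 = mark 0 + 1`. -/
theorem nextMark_one_dobrushin (D : DobrushinDomain) : D.nextMark 1 = D.mark 0 + 1 :=
  D.nextMark_of_not_lt 1 (by decide)

/-- The frontier of a Dobrushin domain is the union of its two closed arcs. -/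
theorem frontier_eq_arc_union_arc (D : DobrushinDomain) :
    frontier D.carrier = D.arc 0 ∪ D.arc 1 := by
  rw [← MarkedDomain.iUnion_arc_holds (D := D)]
  ext z
  simp only [mem_iUnion, mem_union]
  constructor
  · rintro ⟨i, hi⟩
    fin_cases i
    · exact Or.inl hi
    · exact Or.inr hi
  · rintro (h | h)
    · exact ⟨0, h⟩
    · exact ⟨1, h⟩

/-- The two closed arcs of a Dobrushin domain meet only at the marks. -/
theorem eq_pt_of_mem_arc_of_mem_arc (D : DobrushinDomain) {z : ℂ} (h0 : z ∈ D.arc 0)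
    (h1 : z ∈ D.arc 1) : z = D.pt 0 ∨ z = D.pt 1 := by
  obtain ⟨s, hs, rfl⟩ := h0
  rw [nextMark_zero_dobrushin] at hs
  rcases hs.1.eq_or_lt with h | hlt
  · exact Or.inl (by rw [← h]; rfl)
  rcases hs.2.lt_or_eq with hlt' | h
  · exact absurd h1 (D.boundary_not_mem_arc (i := 0) (j := 1) (by decide)
      (by rw [nextMark_zero_dobrushin]; exact ⟨hlt, hlt'⟩))
  · exact Or.inr (by rw [h]; rfl)

/-- An interior point of the arc `arc 0` has a parameter strictly between `mark 0` and `mark 1`. -/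
theorem exists_param_of_mem_arc_zero (D : DobrushinDomain) {z : ℂ} (hz : z ∈ D.arc 0)
    (h0 : z ≠ D.pt 0) (h1 : z ≠ D.pt 1) : ∃ s ∈ Ioo (D.mark 0) (D.mark 1), z = D.boundary s := by
  obtain ⟨s, hs, rfl⟩ := hz
  rw [nextMark_zero_dobrushin] at hs
  refine ⟨s, ⟨lt_of_le_of_ne hs.1 fun h => h0 ?_, lt_of_le_of_ne hs.2 fun h => h1 ?_⟩, rfl⟩
  · rw [← h]; rfl
  · rw [h]; rfl

/-- An interior point of the arc `arc 1` has a parameter strictly between `mark 1` and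
`mark 0 + 1`. -/
theorem exists_param_of_mem_arc_one (D : DobrushinDomain) {z : ℂ} (hz : z ∈ D.arc 1)
    (h0 : z ≠ D.pt 0) (h1 : z ≠ D.pt 1) :
    ∃ t ∈ Ioo (D.mark 1) (D.mark 0 + 1), z = D.boundary t := by
  obtain ⟨t, ht, rfl⟩ := hz
  rw [nextMark_one_dobrushin] at ht
  refine ⟨t, ⟨lt_of_le_of_ne ht.1 fun h => h1 ?_, lt_of_le_of_ne ht.2 fun h => h0 ?_⟩, rfl⟩
  · rw [← h]; rfl
  · rw [h, D.periodic_boundary]; rfl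

/-! ### Lattice bookkeeping -/

/-- The midpoint of a lattice edge is within `|δ|` of both endpoints. -/
theorem dist_medialPoint_le_of_adj {δ : ℝ} {u w : Site 2} (h : (zdGraph 2).Adj u w) :
    dist (medialPoint δ s(u, w)) (meshPoint δ u) ≤ |δ| ∧
      dist (medialPoint δ s(u, w)) (meshPoint δ w) ≤ |δ| := by
  have hd := dist_meshPoint_of_adj (δ := δ) h
  rw [medialPoint_mk]
  constructor
  · rw [dist_eq_norm, show (meshPoint δ u + meshPoint δ w) / 2 - meshPoint δ u =
      (meshPoint δ w - meshPoint δ u) / 2 by ring, norm_div, Complex.norm_ofNat, ← dist_eq_norm,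
      dist_comm, hd]
    linarith [abs_nonneg δ]
  · rw [dist_eq_norm, show (meshPoint δ u + meshPoint δ w) / 2 - meshPoint δ w =
      (meshPoint δ u - meshPoint δ w) / 2 by ring, norm_div, Complex.norm_ofNat, ← dist_eq_norm,
      hd]
    linarith [abs_nonneg δ]

/-- The source edge of a corner of an INNER face is an edge of the discrete domain. -/
theorem adj_of_cornerSource_eq {E : DiscreteDobrushin} {v f u w : Site 2} (hv : IsCorner v f)
    (hf : E.IsInnerFace f) (h : cornerSource v f = s(u, w)) :
    (discreteDomainGraph E.Ω E.δ).Adj u w := by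
  rw [cornerSource_eq_cornerEdge] at h
  have hadj : (discreteDomainGraph E.Ω E.δ).Adj v (cornerNeighbor v f (srcDir v f)) :=
    hf v _ hv (isCorner_cornerNeighbor hv _) (adj_cornerNeighbor hv _)
  have h' : s(v, cornerNeighbor v f (srcDir v f)) = s(u, w) := h
  rw [Sym2.eq_iff] at h'
  rcases h' with ⟨rfl, rfl⟩ | ⟨rfl, rfl⟩
  · exact hadj
  · exact hadj.symm

/-! ### The dirty cross-cut is a simple arc -/

/-- **A first-exit connector meets the mesh trace of the open crossing only at its base point.**
`π` is a lattice walk whose vertices are sites of `Ω_δ`; `{x, y}` is a lattice edge at `x` that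
is NOT an edge of `π`... more precisely not an `Ω_δ`-edge while all edges of `π` are; `f` is a point
of `[δx, δy]` outside `Ω` (the first exit).  Then `[δx, f] ∩ meshTrace δ π ⊆ {δx}`. -/
theorem connector_inter_meshTrace_subset {Ω : Set ℂ} {δ : ℝ} (hδ : 0 < δ) {x y : Site 2}
    (hxy : (zdGraph 2).Adj x y) (hnadj : ¬ (discreteDomainGraph Ω δ).Adj x y)
    {t : ℝ} (ht0 : 0 < t) (ht1 : t ≤ 1) {f : ℂ}
    (hf : f = meshPoint δ x + t • (meshPoint δ y - meshPoint δ x)) (hfΩ : f ∉ Ω)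
    {a b : Site 2} {π : (zdGraph 2).Walk a b}
    (hsupp : ∀ v ∈ π.support, v ∈ meshDomain Ω δ)
    (hedges : ∀ e ∈ π.edges, e ∈ (discreteDomainGraph Ω δ).edgeSet) :
    segment ℝ (meshPoint δ x) f ∩ meshTrace δ π ⊆ {meshPoint δ x} := by
  rintro z ⟨hz, hz'⟩
  rw [mem_singleton_iff]
  have hsub : segment ℝ (meshPoint δ x) f ⊆ meshScale δ '' edgeTrace s(x, y) := by
    rw [← segment_meshPoint_eq_image, hf]; exact subsegment_subset ht0.le ht1
  obtain ⟨z₁, hz₁, rfl⟩ := hsub hz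
  obtain ⟨e', he', z₂, hz₂, hz₁₂⟩ := mem_meshTrace_iff.1 hz'
  obtain rfl : z₂ = z₁ := by
    have h1 : (δ : ℂ) * z₂ = (δ : ℂ) * z₁ := by rw [← meshScale_apply, ← meshScale_apply, hz₁₂]
    exact mul_left_cancel₀ (by exact_mod_cast hδ.ne') h1
  have hne : s(x, y) ≠ e' := by
    rintro rfl
    have := hedges _ he'
    rw [SimpleGraph.mem_edgeSet] at this
    exact hnadj this
  obtain ⟨x', rfl, hx', hx'e⟩ := exists_eq_toComplex_of_mem_edgeTrace_inter hxy
    (π.edges_subset_edgeSet he') hne hz₁ hz₂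
  rw [← meshPoint_eq_meshScale]
  rcases Sym2.mem_iff.1 hx' with rfl | rfl
  · rfl
  · -- `z = δy` on `[δx, f]` forces `t = 1`, `f = δy ∈ Ω`: contradiction
    exfalso
    have hPxy : meshPoint δ x ≠ meshPoint δ x' := fun h => by
      have := dist_meshPoint_of_adj (δ := δ) hxy
      rw [h, dist_self, abs_of_pos hδ] at this
      exact hδ.ne' this.symm
    have hzz : meshPoint δ x' ∈ segment ℝ (meshPoint δ x) f := by
      rw [meshPoint_eq_meshScale δ x']; exact hz
    have ht : t = 1 := eq_one_of_mem_subsegment hPxy ht0 ht1 (hf ▸ hzz)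
    rw [ht, one_smul, add_sub_cancel] at hf
    apply hfΩ
    rw [hf]
    exact meshDomain_subset_meshVertices Ω δ (hsupp x' (π.mem_support_of_mem_edges he' hx'e))

/-- Points of a first-exit connector `[δx, f]` are within `δ` of the base point `δx`. -/
theorem dist_le_of_mem_connector {δ : ℝ} (hδ : 0 < δ) {x y : Site 2} (hxy : (zdGraph 2).Adj x y)
    {t : ℝ} (ht0 : 0 < t) (ht1 : t ≤ 1) {f : ℂ}
    (hf : f = meshPoint δ x + t • (meshPoint δ y - meshPoint δ x)) {z : ℂ}
    (hz : z ∈ segment ℝ (meshPoint δ x) f) : dist z (meshPoint δ x) ≤ δ := by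
  have hfseg : f ∈ segment ℝ (meshPoint δ x) (meshPoint δ y) := by
    rw [hf, segment_eq_image']; exact ⟨t, ⟨ht0.le, ht1⟩, rfl⟩
  have := dist_le_of_mem_segment_of_mem_segment hxy hfseg hz
  rwa [abs_of_pos hδ] at this

/-- **The dirty cross-cut is a simple arc.**  For a lattice PATH `π` from `x` to `y` all of whose
vertices are sites of `Ω_δ` and all of whose edges are `Ω_δ`-edges, and first-exit connectors
`[δx, f_x]`, `[δy, f_y]` along non-`Ω_δ` lattice edges `{x, x'}`, `{y, y'}` (exit points outside
`Ω`), with `δx`, `δy` more than `2δ` apart, the set `[f_x, δx] ∪ meshTrace δ π ∪ [δy, f_y]` is a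
simple arc from `f_x` to `f_y`. -/
theorem isSimpleArc_connector_meshTrace_connector {Ω : Set ℂ} {δ : ℝ} (hδ : 0 < δ)
    {x y x' y' : Site 2} {π : (zdGraph 2).Walk x y} (hπ : π.IsPath) (hn : ¬ π.Nil)
    (hsupp : ∀ v ∈ π.support, v ∈ meshDomain Ω δ)
    (hedges : ∀ e ∈ π.edges, e ∈ (discreteDomainGraph Ω δ).edgeSet)
    (hxx' : (zdGraph 2).Adj x x') (hnx : ¬ (discreteDomainGraph Ω δ).Adj x x')
    (hyy' : (zdGraph 2).Adj y y') (hny : ¬ (discreteDomainGraph Ω δ).Adj y y')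
    {tx : ℝ} (htx0 : 0 < tx) (htx1 : tx ≤ 1) {fx : ℂ}
    (hfx : fx = meshPoint δ x + tx • (meshPoint δ x' - meshPoint δ x)) (hfxΩ : fx ∉ Ω)
    {ty : ℝ} (hty0 : 0 < ty) (hty1 : ty ≤ 1) {fy : ℂ}
    (hfy : fy = meshPoint δ y + ty • (meshPoint δ y' - meshPoint δ y)) (hfyΩ : fy ∉ Ω)
    (hfar : 2 * δ < dist (meshPoint δ x) (meshPoint δ y)) :
    IsSimpleArc ((segment ℝ fx (meshPoint δ x) ∪ meshTrace δ π) ∪ segment ℝ (meshPoint δ y) fy)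
      fx fy := by
  have hxΩ : meshPoint δ x ∈ Ω := meshDomain_subset_meshVertices Ω δ (hsupp x π.start_mem_support)
  have hyΩ : meshPoint δ y ∈ Ω := meshDomain_subset_meshVertices Ω δ (hsupp y π.end_mem_support)
  have hfxne : fx ≠ meshPoint δ x := fun h => hfxΩ (h ▸ hxΩ)
  have hfyne : meshPoint δ y ≠ fy := fun h => hfyΩ (h ▸ hyΩ)
  -- the three pieces
  have A₁ : IsSimpleArc (segment ℝ fx (meshPoint δ x)) fx (meshPoint δ x) :=
    IsSimpleArc.segment hfxne
  have A₂ : IsSimpleArc (meshTrace δ π) (meshPoint δ x) (meshPoint δ y) := by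
    have h := (isSimpleArc_walkTrace hπ hn).image (meshScale δ).continuous_of_finiteDimensional
      (fun z w hzw => mul_left_cancel₀ (by exact_mod_cast hδ.ne' : (δ : ℂ) ≠ 0)
        (by rwa [meshScale_apply, meshScale_apply] at hzw))
    rwa [← meshPoint_eq_meshScale, ← meshPoint_eq_meshScale] at h
  have A₃ : IsSimpleArc (segment ℝ (meshPoint δ y) fy) (meshPoint δ y) fy :=
    IsSimpleArc.segment hfyne
  -- gluing
  have A₁₂ : IsSimpleArc (segment ℝ fx (meshPoint δ x) ∪ meshTrace δ π) fx (meshPoint δ y) := by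
    refine A₁.union A₂ ?_
    rintro z ⟨hz, hz'⟩
    rw [segment_symm] at hz
    exact connector_inter_meshTrace_subset hδ hxx' hnx htx0 htx1 hfx hfxΩ hsupp hedges ⟨hz, hz'⟩
  refine A₁₂.union A₃ ?_
  rintro z ⟨hz | hz, hz'⟩
  · -- the two connectors are far apart
    exfalso
    rw [segment_symm] at hz
    have h1 := dist_le_of_mem_connector hδ hxx' htx0 htx1 hfx hz
    have h2 := dist_le_of_mem_connector hδ hyy' hty0 hty1 hfy hz'
    have := dist_triangle (meshPoint δ x) z (meshPoint δ y)
    rw [dist_comm (meshPoint δ x) z] at this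
    linarith
  · exact connector_inter_meshTrace_subset hδ hyy' hny hty0 hty1 hfy hfyΩ hsupp hedges ⟨hz', hz⟩

/-! ### Cleaning: a genuine Newman cross-cut inside the dirty one -/

/-- Reparametrising a sub-path over `[s, t]` to `[0, 1]` gives a simple arc. -/
theorem isSimpleArc_image_Icc {γ : ℝ → ℂ} (hγ : Continuous γ) (hinj : InjOn γ (Icc 0 1))
    {s t : ℝ} (hs : 0 ≤ s) (hst : s < t) (ht : t ≤ 1) :
    IsSimpleArc (γ '' Icc s t) (γ s) (γ t) := by
  set φ : ℝ → ℝ := fun u => s + u * (t - s) with hφ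
  have hφc : Continuous φ := by fun_prop
  have hφmem : ∀ u ∈ Icc (0 : ℝ) 1, φ u ∈ Icc s t := fun u hu =>
    ⟨by simp only [hφ]; nlinarith [hu.1], by simp only [hφ]; nlinarith [hu.2]⟩
  have hsub : Icc s t ⊆ Icc (0 : ℝ) 1 := Icc_subset_Icc hs ht
  refine ⟨γ ∘ φ, (hγ.comp hφc).continuousOn, ?_, ?_, by simp [hφ], by simp [hφ]⟩
  · intro u hu u' hu' h
    have h1 := hinj (hsub (hφmem u hu)) (hsub (hφmem u' hu')) h
    simp only [hφ] at h1
    have : (u - u') * (t - s) = 0 := by linarith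
    rcases mul_eq_zero.1 this with h2 | h2
    · linarith
    · linarith
  · ext z
    simp only [mem_image, Function.comp_apply]
    constructor
    · rintro ⟨u, hu, rfl⟩
      exact ⟨φ u, hφmem u hu, rfl⟩
    · rintro ⟨v, hv, rfl⟩
      refine ⟨(v - s) / (t - s), ⟨div_nonneg (by linarith [hv.1]) (by linarith),
        (div_le_one (by linarith)).2 (by linarith [hv.2])⟩, ?_⟩
      simp only [hφ]
      rw [div_mul_cancel₀ _ (by linarith : t - s ≠ 0), add_sub_cancel]

/-- **The clean cross-cut.**  A simple arc `L` inside `closure Ω ⊆ closure D` from a point of the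
closed arc `D.arc 0` to a point of `D.arc 1`, the marks of `D` lying off `closure Ω`, contains a
Newman cross-cut `L′` of `D` from `D.boundary s` to `D.boundary t` with
`mark 0 < s < mark 1 < t < mark 0 + 1`; in particular its endpoints lie in `L ⊆ closure Ω`. -/
theorem exists_clean_crosscut (D : DobrushinDomain) {Ω : Set ℂ} (hΩD : closure Ω ⊆ closure D.carrier)
    (hpt : ∀ i : Fin 2, D.pt i ∉ closure Ω) {L : Set ℂ} {fx fy : ℂ} (hL : IsSimpleArc L fx fy)
    (hLΩ : L ⊆ closure Ω) (hfx : fx ∈ D.arc 0) (hfy : fy ∈ D.arc 1) :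
    ∃ (L' : Set ℂ) (s t : ℝ), L' ⊆ L ∧ D.mark 0 < s ∧ s < D.mark 1 ∧ D.mark 1 < t ∧
      t < D.mark 0 + 1 ∧ D.IsCrosscut L' (D.boundary s) (D.boundary t) := by
  obtain ⟨γ, hγ, hinj, hγL, h0, h1⟩ :=
    Literature.Topology.PlaneTopology.isSimpleArc_iff_continuous.1 hL
  have hmemL : ∀ u ∈ Icc (0 : ℝ) 1, γ u ∈ L := fun u hu => hγL ▸ mem_image_of_mem γ hu
  -- contacts with `∂D` lie in the arcs, never in both
  have hnot_pt : ∀ u ∈ Icc (0 : ℝ) 1, ∀ i : Fin 2, γ u ≠ D.pt i := fun u hu i h =>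
    hpt i (h ▸ hLΩ (hmemL u hu))
  obtain ⟨s₁, t₁, hs₁, hst, ht₁, hsA, htB, hclean⟩ :=
    exists_clean_subarc_subset hγ.continuousOn D.isOpen (D.isClosed_arc 0) (D.isClosed_arc 1)
      (fun u hu => hΩD (hLΩ (hmemL u hu)))
      (fun u _ hfr => by rwa [frontier_eq_arc_union_arc, mem_union] at hfr)
      (fun u hu hA hB => by
        rcases eq_pt_of_mem_arc_of_mem_arc D hA hB with h | h
        · exact hnot_pt u hu 0 h
        · exact hnot_pt u hu 1 h)
      (by rw [h0]; exact ⟨D.arc_subset_frontier 0 hfx, hfx⟩)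
      (by rw [h1]; exact ⟨D.arc_subset_frontier 1 hfy, hfy⟩)
  have hs₁I : s₁ ∈ Icc (0 : ℝ) 1 := ⟨hs₁, hst.le.trans ht₁⟩
  have ht₁I : t₁ ∈ Icc (0 : ℝ) 1 := ⟨hs₁.trans hst.le, ht₁⟩
  -- parameters of the two clean endpoints on `∂D`
  obtain ⟨s, hs, hseq⟩ := exists_param_of_mem_arc_zero D hsA.2 (hnot_pt s₁ hs₁I 0) (hnot_pt s₁ hs₁I 1)
  obtain ⟨t, ht, hteq⟩ := exists_param_of_mem_arc_one D htB.2 (hnot_pt t₁ ht₁I 0) (hnot_pt t₁ ht₁I 1)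
  refine ⟨γ '' Icc s₁ t₁, s, t, ?_, hs.1, hs.2, ht.1, ht.2, ?_⟩
  · rw [← hγL]; exact image_mono (Icc_subset_Icc hs₁ ht₁)
  have harc := isSimpleArc_image_Icc hγ hinj hs₁ hst ht₁
  rw [hseq] at hsA harc
  rw [hteq] at htB harc
  refine ⟨harc, hsA.1, htB.1, ?_, ?_⟩
  · -- distinct endpoints (injectivity)
    intro h
    have := hinj hs₁I ht₁I (by rw [← hseq, ← hteq] at h; exact h)
    exact hst.ne this
  · -- interior points lie in `D`
    rintro z ⟨⟨u, hu, rfl⟩, hz⟩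
    rcases hu.1.eq_or_lt with rfl | hlt
    · exact absurd (by rw [hseq]; exact Or.inl rfl) hz
    rcases hu.2.lt_or_eq with hlt' | rfl
    · exact hclean ⟨u, ⟨hlt, hlt'⟩, rfl⟩
    · exact absurd (by rw [hteq]; exact Or.inr rfl) hz

/-- Registered sub-goal of STUB A (Part 3 of `stub_upperFence`), arrow form of
`exists_clean_crosscut`. -/
theorem upperFence_part3 : ∀ (D : DobrushinDomain) (Ω : Set ℂ), closure Ω ⊆ closure D.carrier → (∀ i : Fin 2, D.pt i ∉ closure Ω) → ∀ (L : Set ℂ) (fx fy : ℂ), IsSimpleArc L fx fy → L ⊆ closure Ω → fx ∈ D.arc 0 → fy ∈ D.arc 1 → ∃ (L' : Set ℂ) (s t : ℝ), L' ⊆ L ∧ D.mark 0 < s ∧ s < D.mark 1 ∧ D.mark 1 < t ∧ t < D.mark 0 + 1 ∧ D.IsCrosscut L' (D.boundary s) (D.boundary t) :=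
  fun D _ hΩD hpt _ _ _ hL hLΩ hfx hfy ↦ exists_clean_crosscut D hΩD hpt hL hLΩ hfx hfy

end Summit.CriticalPhenomena.CardyFormulaZ2.Cruxes.SLESixFamiliesGiveCardy.CollarTouchSandwich

end
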